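import Literature.Analysis.ValidatedNumerics.MultiPrecisionBall
import Literature.NumberTheory.LFunctions.ZetaCertifiedEvaluation
import HarnessLib

/-!
# A faster certified evaluator of `ζ(s)` at power-of-two scales

Topic `Literature/NumberTheory/LFunctions`. The certified Euler–Maclaurin evaluator `zetaBox`
(`ZetaCertifiedEvaluation.lean`, soundness `mem_zetaBox`) spends, at the `~1500`–`2500`-digit
precisions of the Best–Trudgian certificate (`MertensCertificateBT.lean`), about `95%` of its
time in the fresh powers `p^{-s} = e^{-σ log p} e^{-it log p}` at the primes `p ≤ N`
(`cpowFresh`: `MI.exp` and `MC.expI` by plain Taylor series and `40` interval squarings — several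
thousand interval products per prime, and a loss of `~45` bits to outward rounding). This file is
a drop-in variant `zetaBoxFast` with the SAME tables (`Tables`, `Tables.Valid`, `mkTables`,
`mkTablesFast`), the same main sum, correction terms and remainder radius, and the same soundness
statement, differing only in the fresh powers:

* the phase `e^{-it log p}` by `MC.expIFast` (`MultiPrecisionBall.lean`: balls at scale
  `2^(sb+guard+k)`, Paterson–Stockmeyer Taylor blocks, `k` angle doublings) — this requires the
  scale to be a power of two, `T.S = 2^sb` (checked);
* the modulus `e^{-σ log p}`: when the box has `σ = ½` exactly (the case of every evaluation on the
  critical line) it is `p^{-1/2} ∈ [⌊√(S²/p)⌋, ⌊√(S²/p)⌋ + 1] / S` by one integer square root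
  (`MI.rsqrtNat`, `MI.mem_rsqrtNat`); otherwise the general `MI.exp` of the tables is used.

Measured in the environment that runs `native_decide` (scale `2^5110`, `N = 2300`, `ν = 1500`,
`guard = 16`, `k = 36`, `m = 10`, `I = 7`): per prime `MC.expI` ≈ 7 ms and `2^47` units wide,
`MC.expIFast` ≈ 2.3 ms and `2^13` units wide; one evaluation of `ζ(½ + 2515.…i)`: `zetaBox` 5.1 s,
width `2^57` units; `zetaBoxFast` 1.36 s, width `2^22` units.

## Main definitions and results (namespace `Literature.NumberTheory.LFunctions.ZetaNumerics`)

* `MI.rsqrtNat`, `MI.mem_rsqrtNat` (in namespace `Literature.Analysis.ValidatedNumerics.NumericsMP`);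
* `FastParams` (`sb, guard, k, m, I`), `cpowFreshFast`, `mem_cpowFreshFast`, `powTableFast`,
  `powTableFast_spec`, **`zetaBoxFast`**, **`mem_zetaBoxFast`** —
  `T.Valid → s ∈ sB → s ≠ 1 → zetaBoxFast T P sB = some Z → ζ(s) ∈ Z`.

## References

* H. M. Edwards, *Riemann's Zeta Function* (1974), §6.4 (Euler–Maclaurin for `ζ`). [Edwards1974]
* R. P. Brent, P. Zimmermann, *Modern Computer Arithmetic* (2010), §4.3–4.4. [BrentZimmermann2010]
-/

open Finset Complex
open Literature.Analysis.ValidatedNumerics.NumericsMP Literature.NumberTheory.LFunctions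

/-! ## `n^{-1/2}` by an integer square root -/

namespace Literature.Analysis.ValidatedNumerics.NumericsMP.MI

/-- `n^{-1/2}` at scale `S`: `[q, q+1]`, `q = ⌊√(⌊S²/n⌋)⌋`. [folklore] -/
def rsqrtNat (S n : ℕ) : MI :=
  let q := Nat.sqrt (S * S / n)
  ⟨q, q + 1⟩

/-- `e^{-½ log n} = n^{-1/2} ∈ rsqrtNat S n` (`n ≥ 1`). [folklore] -/
theorem mem_rsqrtNat (S : ℕ) {n : ℕ} (hn : 1 ≤ n) :
    mem S (Real.exp (-(1 / 2 * Real.log n))) (rsqrtNat S n) := by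
  have hnr : (0 : ℝ) < n := by exact_mod_cast hn
  have hval : Real.exp (-(1 / 2 * Real.log n)) = (Real.sqrt n)⁻¹ := by
    rw [show -(1 / 2 * Real.log n) = Real.log n * (-(1 / 2)) by ring, ← Real.rpow_def_of_pos hnr,
      Real.rpow_neg hnr.le, ← Real.sqrt_eq_rpow]
  rw [hval]
  set m : ℕ := S * S / n with hm
  set q : ℕ := Nat.sqrt m with hq
  have hsq : Real.sqrt n ≠ 0 := (Real.sqrt_pos.2 hnr).ne'
  have hkey : (Real.sqrt n)⁻¹ * S = Real.sqrt ((S : ℝ) * S / n) := by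
    rw [Real.sqrt_div' _ hnr.le, Real.sqrt_mul_self (Nat.cast_nonneg S)]
    field_simp
  simp only [rsqrtNat, mem, ← hm, ← hq]
  rw [hkey]
  have hm_le : (m : ℝ) ≤ (S : ℝ) * S / n := by
    rw [hm]; have := Nat.cast_div_le (α := ℝ) (m := S * S) (n := n); push_cast at this; exact this
  have hm_lt : (S : ℝ) * S / n < (m : ℝ) + 1 := by
    rw [hm]
    have := (nat_fdiv_bounds (S * S) (b := n) (by omega)).2
    push_cast at this; exact this
  constructor
  · -- q ≤ √(S²/n) since q² ≤ m ≤ S²/n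
    have h1 : ((q : ℕ) : ℝ) ^ 2 ≤ m := by exact_mod_cast Nat.sqrt_le' m
    calc ((q : ℤ) : ℝ) = Real.sqrt (((q : ℕ) : ℝ) ^ 2) := by
          rw [Real.sqrt_sq (Nat.cast_nonneg q)]; push_cast; ring
      _ ≤ Real.sqrt ((S : ℝ) * S / n) := Real.sqrt_le_sqrt (h1.trans hm_le)
  · -- √(S²/n) ≤ q + 1 since S²/n < m + 1 ≤ (q+1)²
    have h2 : (m : ℝ) + 1 ≤ (((q : ℕ) : ℝ) + 1) ^ 2 := by
      have := Nat.lt_succ_sqrt' m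
      have : m + 1 ≤ (Nat.sqrt m + 1) ^ 2 := this
      exact_mod_cast this
    calc Real.sqrt ((S : ℝ) * S / n) ≤ Real.sqrt ((((q : ℕ) : ℝ) + 1) ^ 2) :=
          Real.sqrt_le_sqrt (hm_lt.le.trans h2)
      _ = ((q : ℕ) : ℝ) + 1 := Real.sqrt_sq (by positivity)
      _ = (((q : ℤ) + 1 : ℤ) : ℝ) := by push_cast; ring

end Literature.Analysis.ValidatedNumerics.NumericsMP.MI

namespace Literature.NumberTheory.LFunctions.ZetaNumerics

/-! ## Parameters and the fresh powers -/

/-- Parameters of the fast phase evaluation: the scale is `2^sb`; `guard` extra bits and `k`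
angle doublings (working scale `2^(sb+guard+k)`); Taylor blocks of length `m`, `I` blocks
(`2·I·m` Taylor terms). [folklore] -/
structure FastParams where
  /-- bits of the scale: `S = 2^sb` -/
  sb : ℕ
  /-- guard bits -/
  guard : ℕ
  /-- angle doublings -/
  k : ℕ
  /-- Taylor block length -/
  m : ℕ
  /-- number of Taylor blocks -/
  I : ℕ

/-- `n^{-s} = e^{-σ log n} · e^{-i t log n}` from the tables, the phase by `MC.expIFast`, the modulus
by `MI.rsqrtNat` when `σ = ½` exactly (else by `MI.exp`). [folklore] -/
def cpowFreshFast (T : Tables) (P : FastParams) (sB : MC) (n : ℕ) : Option MC :=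
  let L := T.logs.getD n default
  let mag : Option MI :=
    if 2 * sB.re.lo = T.S ∧ sB.re.hi = sB.re.lo then some (MI.rsqrtNat T.S n)
    else MI.exp T.S T.Kexp T.kexp ((sB.re.mul T.S L).neg)
  match mag, MC.expIFast P.sb P.guard P.k P.m P.I T.piI ((sB.im.mul T.S L).neg) with
  | some mg, some ph => some (ph.mulMI T.S mg)
  | _, _ => none

/-- One new entry of the power table. [folklore] -/
def powEntryFast (T : Tables) (P : FastParams) (sB : MC) (A : Array MC) (m : ℕ) : Option MC :=
  if m = 1 then some (MC.ofInt T.S 1)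
  else if m.minFac = m then cpowFreshFast T P sB m
  else
    match A[m.minFac]?, A[m / m.minFac]? with
    | some x, some y => some (MC.mul T.S x y)
    | _, _ => none

/-- The table `[junk, 1^{-s}, 2^{-s}, …, n^{-s}]` of enclosures (multiplicatively from the primes).
[folklore] -/
def powTableFast (T : Tables) (P : FastParams) (sB : MC) : ℕ → Option (Array MC)
  | 0 => some #[MC.ofInt T.S 0]
  | m + 1 =>
    match powTableFast T P sB m with
    | none => none
    | some A =>
      match powEntryFast T P sB A (m + 1) with
      | none => none
      | some b => some (A.push b)

/-- **The fast certified evaluator**: a box containing `ζ(s)` for all `s` in `sB` (requires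
`0 < lo (re sB)` and `T.S = 2^sb`; soundness `mem_zetaBoxFast` additionally needs `s ≠ 1`).
[folklore] -/
def zetaBoxFast (T : Tables) (P : FastParams) (sB : MC) : Option MC :=
  if 0 < sB.re.lo ∧ T.S = 2 ^ P.sb then
    match powTableFast T P sB T.N with
    | none => none
    | some A =>
      match mainBox T sB A with
      | none => none
      | some M => some ((M.add (termsBox T sB A)).widen (remRadius T sB))
  else none

/-! ## Soundness -/

section Soundness

variable {T : Tables} {P : FastParams} {s : ℂ} {sB : MC}

/-- Soundness of `cpowFreshFast`. [folklore] -/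
theorem mem_cpowFreshFast (hT : T.Valid) (hS2 : T.S = 2 ^ P.sb) (hs : MC.mem T.S s sB) {n : ℕ}
    (hn1 : 1 ≤ n) (hnN : n ≤ T.N) {B : MC} (h : cpowFreshFast T P sB n = some B) :
    MC.mem T.S ((n : ℂ) ^ (-s)) B := by
  unfold cpowFreshFast at h
  simp only at h
  split at h
  · rename_i mg ph hmg hph
    simp only [Option.some.injEq] at h
    subst h
    have hL := hT.mem_logs n hn1 hnN
    have h2 : MI.mem T.S (-(s.im * Real.log n)) ((sB.im.mul T.S (T.logs.getD n default)).neg) :=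
      MI.mem_neg (MI.mem_mul hT.S_pos hs.2 hL)
    -- the modulus
    have hm : MI.mem T.S (Real.exp (-(s.re * Real.log n))) mg := by
      split_ifs at hmg with hhalf
      · simp only [Option.some.injEq] at hmg
        subst hmg
        -- `σ = ½`
        have hre : s.re = 1 / 2 := by
          obtain ⟨h2lo, hhi⟩ := hhalf
          have hlo := hs.1.1
          have hhi' := hs.1.2
          rw [hhi] at hhi'
          have heq : s.re * T.S = sB.re.lo := le_antisymm hhi' hlo
          have hSr : (0 : ℝ) < T.S := by exact_mod_cast hT.S_pos
          have h2 : (2 : ℝ) * sB.re.lo = T.S := by exact_mod_cast h2lo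
          field_simp
          nlinarith
        rw [hre]
        exact MI.mem_rsqrtNat T.S hn1
      · have h1 : MI.mem T.S (-(s.re * Real.log n)) ((sB.re.mul T.S (T.logs.getD n default)).neg) :=
          MI.mem_neg (MI.mem_mul hT.S_pos hs.1 hL)
        exact MI.mem_exp hT.S_pos hmg h1
    -- the phase
    have hpi : MI.mem (2 ^ P.sb) Real.pi T.piI := hS2 ▸ hT.mem_pi
    have hp : MC.mem T.S (Complex.exp (((-(s.im * Real.log n) : ℝ) : ℂ) * I)) ph := by
      rw [hS2]; exact MC.mem_expIFast hpi hph (hS2 ▸ h2)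
    rw [natCast_cpow_neg_eq hn1]
    exact MC.mem_mulMI hT.S_pos hp hm
  · simp at h

/-- Soundness of the power table. [folklore] -/
theorem powTableFast_spec (hT : T.Valid) (hS2 : T.S = 2 ^ P.sb) (hs : MC.mem T.S s sB) :
    ∀ (m : ℕ) {A : Array MC}, m ≤ T.N → powTableFast T P sB m = some A →
      A.size = m + 1 ∧ ∀ n : ℕ, 1 ≤ n → n ≤ m → MC.mem T.S ((n : ℂ) ^ (-s)) (A.getD n default)
  | 0, A, _, h => by
    simp only [powTableFast, Option.some.injEq] at h
    subst h
    exact ⟨rfl, fun n h1 h2 ↦ by omega⟩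
  | m + 1, A, hm, h => by
    simp only [powTableFast] at h
    split at h
    · simp at h
    · rename_i A0 hA0
      split at h
      · simp at h
      · rename_i b hb
        simp only [Option.some.injEq] at h
        subst h
        obtain ⟨hsz, hmem⟩ := powTableFast_spec hT hS2 hs m (by omega) hA0
        refine ⟨by simp [hsz], fun n h1 h2 ↦ ?_⟩
        rcases Nat.lt_succ_iff_lt_or_eq.1 (Nat.lt_succ_of_le h2) with hlt | heq
        · have hlt' : n < A0.size := by rw [hsz]; omega
          have := hmem n h1 (Nat.lt_succ_iff.1 hlt)
          rw [Array.getD_eq_getD_getElem?, Array.getElem?_push_lt hlt', Option.getD_some]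
          rw [Array.getD_eq_getD_getElem?, getElem?_pos A0 n hlt', Option.getD_some] at this
          exact this
        · subst heq
          have hidx : (A0.push b)[m + 1]? = some b := by
            rw [← hsz]; exact Array.getElem?_push_size
          rw [Array.getD_eq_getD_getElem?, hidx, Option.getD_some]
          unfold powEntryFast at hb
          split_ifs at hb with h1' hp
          · simp only [Option.some.injEq] at hb
            subst hb
            rw [h1']
            simpa using MC.mem_ofInt T.S 1
          · exact mem_cpowFreshFast hT hS2 hs h1 hm hb
          · split at hb
            · rename_i x y hx hy
              simp only [Option.some.injEq] at hb
              subst hb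
              set p := (m + 1).minFac with hpdef
              have hpd : p ∣ m + 1 := Nat.minFac_dvd _
              have hpr : p.Prime := Nat.minFac_prime h1'
              have hp2 : 2 ≤ p := hpr.two_le
              have hple : p ≤ m + 1 := Nat.minFac_le (by omega)
              have hplt : p < m + 1 := lt_of_le_of_ne hple hp
              have hq1 : 1 ≤ (m + 1) / p := by
                rw [Nat.one_le_div_iff (by omega)]; exact hple
              have hqlt : (m + 1) / p < m + 1 := Nat.div_lt_self (by omega) (by omega)
              have hxm : MC.mem T.S ((p : ℂ) ^ (-s)) x := by
                have := hmem p (by omega) (by omega)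
                rwa [Array.getD_eq_getD_getElem?, hx, Option.getD_some] at this
              have hym : MC.mem T.S ((((m + 1) / p : ℕ) : ℂ) ^ (-s)) y := by
                have := hmem ((m + 1) / p) hq1 (by omega)
                rwa [Array.getD_eq_getD_getElem?, hy, Option.getD_some] at this
              have key : (((m + 1 : ℕ) : ℂ)) ^ (-s) = (p : ℂ) ^ (-s) * (((m + 1) / p : ℕ) : ℂ) ^ (-s) := by
                rw [← natCast_mul_natCast_cpow, ← Nat.cast_mul, Nat.mul_div_cancel' hpd]
              rw [key]
              exact MC.mem_mul hT.S_pos hxm hym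
            · simp at hb

/-- **Soundness of the fast certified evaluator.** [folklore] -/
theorem mem_zetaBoxFast (hT : T.Valid) (hs : MC.mem T.S s sB) (hs1 : s ≠ 1) {Z : MC}
    (h : zetaBoxFast T P sB = some Z) : MC.mem T.S (riemannZeta s) Z := by
  unfold zetaBoxFast at h
  split_ifs at h with hc
  obtain ⟨hlo, hS2⟩ := hc
  split at h
  · simp at h
  · rename_i A hA
    split at h
    · simp at h
    · rename_i M hM
      simp only [Option.some.injEq] at h
      subst h
      have hσ : 0 < s.re := MI.pos_of_lo_pos hs.1 hlo
      have hN1 : 1 ≤ T.N := le_trans (by norm_num) hT.two_le_N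
      obtain ⟨-, hApow⟩ := powTableFast_spec hT hS2 hs T.N le_rfl hA
      have hmain := mem_mainBox hT hs hApow hM
      have hterms := mem_termsBox hT hs hApow
      have hsum := MC.mem_add hmain hterms
      rw [riemannZeta_eq_eulerMaclaurin_of_re_pos hN1 hσ hs1 T.nu]
      apply MC.mem_widen hsum
      rw [show emMainZero T.N s + ∑ k ∈ Finset.Icc 1 T.nu, emTerm T.N s k + emRemHigher T.N T.nu s -
        (emMainZero T.N s + ∑ j ∈ Finset.Icc 1 T.nu, emTerm T.N s j) = emRemHigher T.N T.nu s by ring]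
      exact norm_emRem_mul_le_remRadius hT hs hσ

end Soundness

end Literature.NumberTheory.LFunctions.ZetaNumerics
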